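import Summits.CriticalPhenomena.PercolationContinuityZ3.Theorems.PercNearOneGluingNoHeavyPcintBSMRTail
import Summits.CriticalPhenomena.PercolationContinuityZ3.Theorems.PercNearOneGluingNoHeavyPcintBSMXChunks
import HarnessLib

/-!
# PCINT lane, PHASE 9 (block renewal with reach-`m` pieces), step 6: windowed fixed-point rows and chunked Green tables

Cell `prim-pcint`, seat `prim-pcint-1` (gen 17); memo `run/shared/lean/prim/pcint/T-FIBRE-ROUTE.md` §PHASE 9.

Kernel mirrors of the Green ingredients of `BSMR.criticalProb_le_of_cert`, for the law `A/DA` on `2m+1` letters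
(…PcintBSMRTail, `BSMR.lawN`).  A row is a list of `2W+1` naturals, index `j ↔ δ = j - W`, bounding `H n δ · D` from
above (`BSMR.RowDom`); outside the window the virtual value is `D ≥ H · D`.  One step (**`BSMR.hstep`**) is the
`(2m+1)`-term stencil of the reflected recursion `BSMR.H_succ'` in ONE linear pass (`BSMR.gpass`, state = the last
`2m` virtual entries; `BSMR.dotL`) over the padded row, rounded upwards; **`BSMR.rowDom_step`** is its soundness.
Rows restarted from checkpoint literals (`BSMR.hrowFrom`, `BSMR.rowDom_chain` with the Boolean test `BSMX.rowLE`),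
chunk term data (`BSMR.termsFrom`, short tables `BSMX.hvals` on `[-Dd, Dd]`) feeding the PHASE-5 fixed-point Green
sum `BSM.GqN`, and the assembly **`BSMR.G0H_le_of_chunks`** / **`BSMR.G1H_le_of_chunks`** of the real-form
Green-table hypotheses from per-chunk table checks and one summation check — exactly as …PcintBSMXChunks
(one chunk = the plain windowed computation of …PcintBSMXCompute).
-/

noncomputable section

namespace Summit.CriticalPhenomena.PercolationContinuityZ3.Theorems.Pcint.BSMR

open Finset OSM BSM Literature.Probability.Percolation Literature.Probability.LatticeModels

variable {m t k : ℕ}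

/-! ### The stencil as one linear pass -/

/-- Truncated dot product: `Σ_i C[i] · v[i]` over the length of `C` (missing entries of `v` count `0`). -/
def dotL : List ℕ → List ℕ → ℕ
  | [], _ => 0
  | _ :: _, [] => 0
  | c :: cs, x :: xs => c * x + dotL cs xs

/-- `dotL` as a sum, when `v` is long enough. -/
theorem dotL_eq : ∀ (C v : List ℕ), C.length ≤ v.length → dotL C v = ∑ i ∈ range C.length, C.getD i 0 * v.getD i 0
  | [], v, _ => by simp [dotL]
  | c :: cs, [], h => by simp at h
  | c :: cs, x :: xs, h => by
    rw [dotL, List.length_cons, Finset.sum_range_succ', dotL_eq cs xs (by simpa using h)]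
    simp only [List.getD_cons_succ, List.getD_cons_zero]
    ring

/-- **One linear pass of the stencil**: with state `st` (the previous virtual entries) and input `x :: rest`, emit
`dotL C (st ++ x :: rest)` (only `|C|` entries are read) and shift the state. -/
def gpass (C : List ℕ) : List ℕ → List ℕ → List ℕ
  | [], _ => []
  | x :: rest, st => dotL C (st ++ x :: rest) :: gpass C rest ((st ++ [x]).drop 1)

/-- Length of the linear pass. -/
theorem length_gpass (C : List ℕ) : ∀ (l st : List ℕ), (gpass C l st).length = l.length
  | [], _ => rfl
  | x :: rest, st => by rw [gpass, List.length_cons, length_gpass, List.length_cons]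

/-- Entries of the linear pass, in terms of the virtual list `st ++ l`. -/
theorem gpass_getD (C : List ℕ) : ∀ (l st : List ℕ) (j : ℕ), j < l.length →
    (gpass C l st).getD j 0 = dotL C ((st ++ l).drop j)
  | [], st, j, hj => by simp at hj
  | x :: rest, st, 0, _ => by rw [gpass, List.getD_cons_zero, List.drop_zero]
  | x :: rest, st, j + 1, hj => by
    rw [gpass, List.getD_cons_succ, gpass_getD C rest _ j (by simpa using hj)]
    congr 1
    rcases st with _ | ⟨s, st'⟩
    · rfl
    · simp only [List.cons_append, List.drop_succ_cons, List.drop_zero, List.append_assoc, List.nil_append]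

/-! ### One step of the rows -/

/-- The padded row: `m` virtual entries `D` on each side. -/
def padRow (m D : ℕ) (row : List ℕ) : List ℕ := List.replicate m D ++ (row ++ List.replicate m D)

/-- Length of the padded row. -/
theorem length_padRow (m D : ℕ) (row : List ℕ) : (padRow m D row).length = row.length + 2 * m := by
  unfold padRow; simp; omega

/-- Entries of the padded row. -/
theorem padRow_getD (m D : ℕ) {row : List ℕ} {L : ℕ} (hL : row.length = L) (p : ℕ) (hp : p < L + 2 * m) :
    (padRow m D row).getD p 0 = if p < m then D else if p < L + m then row.getD (p - m) 0 else D := by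
  unfold padRow
  by_cases h1 : p < m
  · rw [if_pos h1, List.getD_append _ _ _ _ (by simpa using h1), List.getD_eq_getElem?_getD,
      List.getElem?_replicate_of_lt h1]
    rfl
  · rw [if_neg h1, List.getD_append_right _ _ _ _ (by simpa using Nat.le_of_not_lt h1), List.length_replicate]
    by_cases h2 : p < L + m
    · rw [if_pos h2, List.getD_append _ _ _ _ (by rw [hL]; omega)]
    · rw [if_neg h2, List.getD_append_right _ _ _ _ (by rw [hL]; omega), hL, List.getD_eq_getElem?_getD,
        List.getElem?_replicate_of_lt (by omega)]
      rfl

/-- **One step of the windowed `(2m+1)`-term recursion** from an arbitrary row (law numerators `A`, rounding up by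
`DA`, virtual boundary value `D`). -/
def hstep (m : ℕ) (A : List ℕ) (DA D : ℕ) (row : List ℕ) : List ℕ :=
  let P := padRow m D row
  (gpass A (P.drop (2 * m)) (P.take (2 * m))).map (cdiv DA)

/-- The step preserves the length. -/
theorem length_hstep (m : ℕ) (A : List ℕ) (DA D : ℕ) {row : List ℕ} {W : ℕ} (h : row.length = 2 * W + 1) :
    (hstep m A DA D row).length = 2 * W + 1 := by
  unfold hstep
  simp only [List.length_map, length_gpass, List.length_drop, length_padRow, h]
  omega

/-- **Entries of one step**, for `j ≤ 2W`: the rounded stencil of the padded row at positions `j, …, j + 2m`. -/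
theorem hstep_getD (m : ℕ) {A : List ℕ} (hA : A.length = 2 * m + 1) (DA D : ℕ) {row : List ℕ} {W : ℕ}
    (h : row.length = 2 * W + 1) (j : ℕ) (hj : j ≤ 2 * W) :
    (hstep m A DA D row).getD j 0 =
      cdiv DA (∑ i ∈ range (2 * m + 1), A.getD i 0 * (padRow m D row).getD (j + i) 0) := by
  have hP := length_padRow m D row
  unfold hstep
  rw [getD_map_cdiv, gpass_getD A _ _ j (by rw [List.length_drop, hP, h]; omega), List.take_append_drop,
    dotL_eq A _ (by rw [List.length_drop, hP, h, hA]; omega), hA]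
  simp_rw [List.getD_eq_getElem?_getD, List.getElem?_drop]

/-! ### Domination of rows -/

/-- **Row domination**: `row` has the window length and dominates `H n · D` on the window. -/
def RowDom (m : ℕ) (A : List ℕ) (DA D W n : ℕ) (row : List ℕ) : Prop :=
  row.length = 2 * W + 1 ∧ ∀ j ≤ 2 * W, H m (lawN m A DA) n ((j : ℤ) - W) * D ≤ (row.getD j 0 : ℝ)

/-- Row `0 = 𝟙[δ = 0] · D`. -/
def row0 (D W : ℕ) : List ℕ := (List.range (2 * W + 1)).map fun j : ℕ => if j = W then D else 0

/-- Row `0` dominates. -/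
theorem rowDom_zero (m : ℕ) (A : List ℕ) (DA D W : ℕ) : RowDom m A DA D W 0 (row0 D W) := by
  refine ⟨by simp [row0], fun j hj => ?_⟩
  rw [row0, getD_map_range _ _ (by omega), H_zero]
  by_cases h : j = W
  · subst h; simp
  · rw [if_neg (by omega), if_neg h]; simp

/-- `H · D ≤ D` (the virtual value outside the window). -/
theorem H_mul_le {A : List ℕ} {DA : ℕ} (hA : LawNatOK m A DA) (D n : ℕ) (δ : ℤ) :
    H m (lawN m A DA) n δ * D ≤ (D : ℝ) := by
  have := H_le_one (lawOK_of_nat hA) n δ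
  have hD : (0 : ℝ) ≤ D := Nat.cast_nonneg D
  nlinarith

/-- **The step preserves domination.** -/
theorem rowDom_step {A : List ℕ} {DA : ℕ} (hA : LawNatOK m A DA) (hlen : A.length = 2 * m + 1) {D W n : ℕ}
    {row : List ℕ} (hr : RowDom m A DA D W n row) : RowDom m A DA D W (n + 1) (hstep m A DA D row) := by
  obtain ⟨hL, hdomr⟩ := hr
  refine ⟨length_hstep m A DA D hL, fun j hj => ?_⟩
  have hDA0 : 0 < DA := hA.1
  have hDAR : (0 : ℝ) < DA := by exact_mod_cast hDA0
  have hg := lawOK_of_nat hA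
  set g := lawN m A DA with hgdef
  set P := padRow m D row with hP
  -- every padded entry dominates: position `p` of `P` is `δ = p - m - W`
  have hdom : ∀ p, p < 2 * W + 1 + 2 * m → H m g n ((p : ℤ) - m - W) * D ≤ (P.getD p 0 : ℝ) := by
    intro p hp
    rw [hP, padRow_getD m D hL p hp]
    split_ifs with h1 h2
    · exact H_mul_le hA D n _
    · have := hdomr (p - m) (by omega)
      rwa [show (((p - m : ℕ) : ℤ) - W) = (p : ℤ) - m - W by push_cast [Nat.cast_sub (by omega : m ≤ p)]; ring]
        at this
    · exact H_mul_le hA D n _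
  rw [hstep_getD m hlen DA D hL j hj]
  refine le_trans ?_ (le_cdiv hDA0 _)
  rw [H_succ' hg]
  have e1 : (∑ c : Fin (2 * m + 1), g c * H m g n ((j : ℤ) - W + val m c)) * D =
      ∑ i ∈ range (2 * m + 1), ((A.getD i 0 : ℕ) : ℝ) / DA * (H m g n ((j : ℤ) - W + ((i : ℤ) - m)) * D) := by
    rw [Finset.sum_mul, ← Fin.sum_univ_eq_sum_range
      (fun i => ((A.getD i 0 : ℕ) : ℝ) / DA * (H m g n ((j : ℤ) - W + ((i : ℤ) - m)) * D))]
    refine sum_congr rfl fun c _ => ?_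
    rw [hgdef, lawN_apply, val]
    ring
  have e2 : ∀ i ∈ range (2 * m + 1), ((A.getD i 0 : ℕ) : ℝ) / DA * (H m g n ((j : ℤ) - W + ((i : ℤ) - m)) * D) ≤
      ((A.getD i 0 : ℕ) : ℝ) / DA * (P.getD (j + i) 0 : ℝ) := by
    intro i hi
    rw [mem_range] at hi
    refine mul_le_mul_of_nonneg_left ?_ (by positivity)
    have := hdom (j + i) (by omega)
    rwa [show (((j + i : ℕ) : ℤ) - m - W) = (j : ℤ) - W + ((i : ℤ) - m) by push_cast; ring] at this
  rw [e1]
  refine (sum_le_sum e2).trans (le_of_eq ?_)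
  push_cast
  rw [Finset.sum_div]
  exact sum_congr rfl fun i _ => by ring

/-! ### Rows from checkpoints -/

/-- `j` steps from a start row. -/
def hrowFrom (m : ℕ) (A : List ℕ) (DA D : ℕ) (start : List ℕ) : ℕ → List ℕ
  | 0 => start
  | j + 1 => hstep m A DA D (hrowFrom m A DA D start j)

/-- **Rows from a dominating checkpoint dominate.** -/
theorem rowDom_from {A : List ℕ} {DA : ℕ} (hA : LawNatOK m A DA) (hlen : A.length = 2 * m + 1) {D W n : ℕ}
    {start : List ℕ} (hs : RowDom m A DA D W n start) : ∀ j, RowDom m A DA D W (n + j) (hrowFrom m A DA D start j)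
  | 0 => hs
  | j + 1 => by
    rw [hrowFrom, ← add_assoc]
    exact rowDom_step hA hlen (rowDom_from hA hlen hs j)

/-- Domination passes to entrywise larger rows (the Boolean test `BSMX.rowLE`). -/
theorem rowDom_of_rowLE {A : List ℕ} {DA D W n : ℕ} {r s : List ℕ} (hr : RowDom m A DA D W n r)
    (hle : BSMX.rowLE r s = true) : RowDom m A DA D W n s := by
  obtain ⟨hlen, hdom⟩ := hr
  obtain ⟨hlen', hle⟩ := BSMX.rowLE_spec hle
  refine ⟨by rw [← hlen', hlen], fun j hj => (hdom j hj).trans ?_⟩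
  exact_mod_cast hle j (by rw [← hlen', hlen]; omega)

/-- **A chain of checkpoints**: `starts[0] = row 0` and `hrowFrom starts[c] L' ≤ starts[c+1]` entrywise for
`c + 1 < C` ⇒ `starts[c]` dominates row `c · L'` for every `c < C`. -/
theorem rowDom_chain {A : List ℕ} {DA : ℕ} (hA : LawNatOK m A DA) (hlen : A.length = 2 * m + 1) (D W L' : ℕ)
    (starts : List (List ℕ)) (C : ℕ) (h0 : starts.getD 0 [] = row0 D W)
    (hnext : ∀ c ∈ List.range (C - 1),
      BSMX.rowLE (hrowFrom m A DA D (starts.getD c []) L') (starts.getD (c + 1) []) = true) :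
    ∀ c < C, RowDom m A DA D W (c * L') (starts.getD c []) := by
  intro c
  induction c with
  | zero => intro _; rw [h0, Nat.zero_mul]; exact rowDom_zero m A DA D W
  | succ c ih =>
    intro hc
    have hprev := ih (by omega)
    have hle := hnext c (List.mem_range.2 (by omega))
    have := rowDom_from hA hlen hprev L'
    rw [show (c + 1) * L' = c * L' + L' by ring]
    exact rowDom_of_rowLE this hle

/-! ### Chunk Green sums -/

/-- All rows `0..M` from a start row, built with sharing. -/
def hrowsFrom (m : ℕ) (A : List ℕ) (DA D : ℕ) (start : List ℕ) : ℕ → List (List ℕ)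
  | 0 => [start]
  | M + 1 =>
    let rs := hrowsFrom m A DA D start M
    rs ++ [hstep m A DA D (rs.getD M [])]

/-- The list of rows is correct. -/
theorem hrowsFrom_getD (m : ℕ) (A : List ℕ) (DA D : ℕ) (start : List ℕ) :
    ∀ (M n : ℕ), n ≤ M → (hrowsFrom m A DA D start M).getD n [] = hrowFrom m A DA D start n ∧
      (hrowsFrom m A DA D start M).length = M + 1
  | 0, n, hn => by
    have : n = 0 := by omega
    subst this; exact ⟨rfl, rfl⟩
  | M + 1, n, hn => by
    have hl : (hrowsFrom m A DA D start M).length = M + 1 := (hrowsFrom_getD m A DA D start M 0 (Nat.zero_le _)).2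
    refine ⟨?_, by simp [hrowsFrom, hl]⟩
    show (hrowsFrom m A DA D start M ++ [_]).getD n [] = hrowFrom m A DA D start n
    rcases Nat.lt_or_ge n (M + 1) with h | h
    · rw [List.getD_append _ _ _ _ (by rw [hl]; exact h)]
      exact (hrowsFrom_getD m A DA D start M n (by omega)).1
    · have hn' : n = M + 1 := by omega
      subst hn'
      rw [List.getD_append_right _ _ _ _ (by rw [hl])]
      rw [hl, Nat.sub_self, List.getD_cons_zero, (hrowsFrom_getD m A DA D start M M le_rfl).1]
      rfl

/-- The term data of a chunk of `L` terms started at term `i₀` (rows from the checkpoint for row `2 i₀`):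
`(Wc_{i₀+j}, short table of row 2j on [-Dd, Dd])`, `j < L`. -/
def termsFrom (m : ℕ) (A : List ℕ) (DA D : ℕ) (start : List ℕ) (W Dd L i₀ : ℕ) (Wc : List ℕ) :
    List (ℕ × List ℕ) :=
  let rs := hrowsFrom m A DA D start (2 * L)
  List.ofFn fun j : Fin L => (Wc.getD (i₀ + j) 0, BSMX.hvals (rs.getD (2 * j) []) W Dd)

/-- **A chunk Green sum dominates** the true partial sum over `[i₀, i₀ + L)` (scaled by `DU · D^t`). -/
theorem sum_Ico_le_GqNfrom {A : List ℕ} {DA : ℕ} (hA : LawNatOK m A DA) (hlen : A.length = 2 * m + 1)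
    {D DU W Dd L i₀ : ℕ} (hDd : Dd ≤ W) {start : List ℕ} (hs : RowDom m A DA D W (2 * i₀) start) {Wc : List ℕ}
    {c : ℕ → ℝ} (hcW : ∀ i < i₀ + L, c i * DU ≤ (Wc.getD i 0 : ℝ)) {δ : Fin t → ℤ} (hδ : δ ∈ Box t Dd) :
    (∑ i ∈ Ico i₀ (i₀ + L), c i * ∏ l, H m (lawN m A DA) (2 * i) (δ l)) * ((DU : ℝ) * (D : ℝ) ^ t) ≤
      ((GqN (termsFrom m A DA D start W Dd L i₀ Wc) Dd δ : ℕ) : ℝ) := by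
  rw [mem_Box] at hδ
  have hg := lawOK_of_nat hA
  set g := lawN m A DA
  unfold GqN termsFrom
  rw [List.map_ofFn, List.sum_ofFn, Finset.sum_Ico_eq_sum_range, Nat.add_sub_cancel_left, ← Fin.sum_univ_eq_sum_range,
    sum_mul]
  push_cast
  refine sum_le_sum fun j _ => ?_
  have hjL : (j : ℕ) < L := j.2
  simp only [Function.comp_apply]
  rw [(hrowsFrom_getD m A DA D start (2 * L) (2 * j) (by omega)).1]
  have hrow := rowDom_from hA hlen hs (2 * j)
  rw [show 2 * i₀ + 2 * (j : ℕ) = 2 * (i₀ + j) by ring] at hrow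
  have hT : ∀ l, H m g (2 * (i₀ + j)) (δ l) * D ≤
      (((BSMX.hvals (hrowFrom m A DA D start (2 * j)) W Dd).getD (δ l + Dd).toNat 0 : ℕ) : ℝ) := by
    intro l
    unfold BSMX.hvals
    rw [getD_map_range _ _ (by have := hδ l; omega)]
    have := hrow.2 ((δ l + Dd).toNat + W - Dd) (by have := hδ l; omega)
    rwa [show ((((δ l + Dd).toNat + W - Dd : ℕ) : ℤ) - W) = δ l by have := hδ l; omega] at this
  have hH0 : ∀ l, 0 ≤ H m g (2 * (i₀ + j)) (δ l) := fun l => H_nonneg hg _ _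
  calc c (i₀ + j) * (∏ l, H m g (2 * (i₀ + (j : ℕ))) (δ l)) * ((DU : ℝ) * (D : ℝ) ^ t)
      = (c (i₀ + j) * DU) * ∏ l, (H m g (2 * (i₀ + j)) (δ l) * D) := by
        rw [prod_mul_distrib, prod_const, Finset.card_univ, Fintype.card_fin]; ring
    _ ≤ (Wc.getD (i₀ + j) 0 : ℝ) *
          ∏ l, (((BSMX.hvals (hrowFrom m A DA D start (2 * j)) W Dd).getD (δ l + Dd).toNat 0 : ℕ) : ℝ) := by
        refine mul_le_mul (hcW (i₀ + j) (by omega)) (prod_le_prod (fun l _ => mul_nonneg (hH0 l) (by positivity))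
          fun l _ => hT l) (prod_nonneg fun l _ => mul_nonneg (hH0 l) (by positivity)) (by positivity)
    _ = _ := by push_cast; rfl

/-! ### Assembling the Green-table hypotheses from chunks -/

/-- **The Green tables from chunked checks** (generic coefficients `c_i` with `c_i · DU ≤ Wc_i`):
the per-chunk table checks and the summation check give `Σ_{i<CL} c_i Π H(2i) · DG ≤ Gn δ` (Green box `[-Dd,Dd]^t`). -/
theorem green_le_of_chunks {A : List ℕ} {DA : ℕ} (hA : LawNatOK m A DA) (hlen : A.length = 2 * m + 1)
    {D DU W Dd L C : ℕ} (hD : 0 < D) (hDU : 0 < DU) (hW : Dd ≤ W) (starts : List (List ℕ))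
    (h0 : starts.getD 0 [] = row0 D W)
    (hnext : ∀ c ∈ List.range (C - 1),
      BSMX.rowLE (hrowFrom m A DA D (starts.getD c []) (2 * L)) (starts.getD (c + 1) []) = true)
    {Wc : List ℕ} {c : ℕ → ℝ} (hcW : ∀ i < C * L, c i * DU ≤ (Wc.getD i 0 : ℝ))
    (Ptab : ℕ → (Fin t → ℤ) → ℕ) {DG : ℕ} {Gn : (Fin t → ℤ) → ℕ} {δ : Fin t → ℤ} (hδ : δ ∈ Box t Dd)
    (hparts : ∀ cc ∈ List.range C, GqN (termsFrom m A DA D (starts.getD cc []) W Dd L (cc * L) Wc) Dd δ ≤ Ptab cc δ)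
    (hsum : ((List.range C).map fun cc => Ptab cc δ).sum * DG ≤ Gn δ * (DU * D ^ t)) :
    (∑ i ∈ range (C * L), c i * ∏ l, H m (lawN m A DA) (2 * i) (δ l)) * DG ≤ Gn δ := by
  have hM : (0 : ℝ) < (DU : ℝ) * (D : ℝ) ^ t := by positivity
  have hdom := rowDom_chain hA hlen D W (2 * L) starts C h0 hnext
  have hchunk : ∀ cc < C, (∑ i ∈ Ico (cc * L) (cc * L + L), c i * ∏ l, H m (lawN m A DA) (2 * i) (δ l)) *
      ((DU : ℝ) * (D : ℝ) ^ t) ≤ (Ptab cc δ : ℝ) := by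
    intro cc hcc
    have hs := hdom cc hcc
    rw [show cc * (2 * L) = 2 * (cc * L) by ring] at hs
    refine (sum_Ico_le_GqNfrom hA hlen hW hs (fun i hi => hcW i ?_) hδ).trans ?_
    · have : cc * L + L ≤ C * L := by nlinarith
      omega
    · exact_mod_cast hparts cc (List.mem_range.2 hcc)
  have htot : (∑ i ∈ range (C * L), c i * ∏ l, H m (lawN m A DA) (2 * i) (δ l)) *
      ((DU : ℝ) * (D : ℝ) ^ t) ≤ ∑ cc ∈ range C, (Ptab cc δ : ℝ) := by
    rw [BSMX.sum_range_mul_eq_sum_chunks, sum_mul]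
    exact sum_le_sum fun cc hcc => hchunk cc (mem_range.1 hcc)
  have hsum' : (∑ cc ∈ range C, (Ptab cc δ : ℝ)) * DG ≤ (Gn δ : ℝ) * ((DU : ℝ) * (D : ℝ) ^ t) := by
    have := hsum
    have e : ((List.range C).map fun cc => Ptab cc δ).sum = ∑ cc ∈ range C, Ptab cc δ := by
      rw [← List.sum_toFinset _ List.nodup_range, List.toFinset_range]
    rw [e] at this
    exact_mod_cast this
  have hDG : (0 : ℝ) ≤ DG := Nat.cast_nonneg DG
  nlinarith [mul_le_mul_of_nonneg_right htot hDG]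

/-- **The diagonal Green table from chunked checks.** -/
theorem G0H_le_of_chunks {A : List ℕ} {DA : ℕ} (hA : LawNatOK m A DA) (hlen : A.length = 2 * m + 1)
    {D DU W Dd L C : ℕ} (hD : 0 < D) (hDU : 0 < DU) (hW : Dd ≤ W) (starts : List (List ℕ))
    (h0 : starts.getD 0 [] = row0 D W)
    (hnext : ∀ c ∈ List.range (C - 1),
      BSMX.rowLE (hrowFrom m A DA D (starts.getD c []) (2 * L)) (starts.getD (c + 1) []) = true)
    {U : List ℕ} (hU : ∀ i < C * L, u k i * DU ≤ (U.getD i 0 : ℝ))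
    (Ptab : ℕ → (Fin t → ℤ) → ℕ) {DG : ℕ} {G0n : (Fin t → ℤ) → ℕ} {δ : Fin t → ℤ} (hδ : δ ∈ Box t Dd)
    (hparts : ∀ cc ∈ List.range C, GqN (termsFrom m A DA D (starts.getD cc []) W Dd L (cc * L) U) Dd δ ≤ Ptab cc δ)
    (hsum : ((List.range C).map fun cc => Ptab cc δ).sum * DG ≤ G0n δ * (DU * D ^ t)) :
    G0H k m (lawN m A DA) (C * L) δ * DG ≤ G0n δ :=
  green_le_of_chunks hA hlen hD hDU hW starts h0 hnext hU Ptab hδ hparts hsum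

/-- **The adjacent Green table from chunked checks.** -/
theorem G1H_le_of_chunks {A : List ℕ} {DA : ℕ} (hA : LawNatOK m A DA) (hlen : A.length = 2 * m + 1)
    {D DU W Dd L C : ℕ} (hD : 0 < D) (hDU : 0 < DU) (hW : Dd ≤ W) (starts : List (List ℕ))
    (h0 : starts.getD 0 [] = row0 D W)
    (hnext : ∀ c ∈ List.range (C - 1),
      BSMX.rowLE (hrowFrom m A DA D (starts.getD c []) (2 * L)) (starts.getD (c + 1) []) = true)
    {Cl : List ℕ} (hC : ∀ i < C * L, cadj k i * DU ≤ (Cl.getD i 0 : ℝ))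
    (Ptab : ℕ → (Fin t → ℤ) → ℕ) {DG : ℕ} {G1n : (Fin t → ℤ) → ℕ} {δ : Fin t → ℤ} (hδ : δ ∈ Box t Dd)
    (hparts : ∀ cc ∈ List.range C, GqN (termsFrom m A DA D (starts.getD cc []) W Dd L (cc * L) Cl) Dd δ ≤ Ptab cc δ)
    (hsum : ((List.range C).map fun cc => Ptab cc δ).sum * DG ≤ G1n δ * (DU * D ^ t)) :
    G1H k m (lawN m A DA) (C * L) δ * DG ≤ G1n δ :=
  green_le_of_chunks hA hlen hD hDU hW starts h0 hnext hC Ptab hδ hparts hsum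

/-- **The single-chunk case** (plain windowed computation from row `0`): with `Cnt = 1` the chain condition is
vacuous, and the check reads `GqN (termsFrom … (row0 D W) W Dd N 0 U) Dd δ · DG ≤ G0n δ · (DU · D^t)`. -/
theorem G0H_le_of_check {A : List ℕ} {DA : ℕ} (hA : LawNatOK m A DA) (hlen : A.length = 2 * m + 1)
    {D DU W Dd N : ℕ} (hD : 0 < D) (hDU : 0 < DU) (hW : Dd ≤ W)
    {U : List ℕ} (hU : ∀ i < N, u k i * DU ≤ (U.getD i 0 : ℝ)) {DG : ℕ} {G0n : (Fin t → ℤ) → ℕ}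
    {δ : Fin t → ℤ} (hδ : δ ∈ Box t Dd)
    (h : GqN (termsFrom m A DA D (row0 D W) W Dd N 0 U) Dd δ * DG ≤ G0n δ * (DU * D ^ t)) :
    G0H k m (lawN m A DA) N δ * DG ≤ G0n δ := by
  have := G0H_le_of_chunks (k := k) (L := N) (C := 1) hA hlen hD hDU hW [row0 D W] rfl
    (fun c hc => by simp at hc) (by simpa using hU) (fun _ δ => GqN (termsFrom m A DA D (row0 D W) W Dd N 0 U) Dd δ)
    hδ (fun cc hcc => by
      have : cc = 0 := by simpa using hcc
      subst this; simp) (by simpa using h)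
  simpa using this

/-- **The single-chunk case, adjacent table.** -/
theorem G1H_le_of_check {A : List ℕ} {DA : ℕ} (hA : LawNatOK m A DA) (hlen : A.length = 2 * m + 1)
    {D DU W Dd N : ℕ} (hD : 0 < D) (hDU : 0 < DU) (hW : Dd ≤ W)
    {Cl : List ℕ} (hC : ∀ i < N, cadj k i * DU ≤ (Cl.getD i 0 : ℝ)) {DG : ℕ} {G1n : (Fin t → ℤ) → ℕ}
    {δ : Fin t → ℤ} (hδ : δ ∈ Box t Dd)
    (h : GqN (termsFrom m A DA D (row0 D W) W Dd N 0 Cl) Dd δ * DG ≤ G1n δ * (DU * D ^ t)) :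
    G1H k m (lawN m A DA) N δ * DG ≤ G1n δ := by
  have := G1H_le_of_chunks (k := k) (L := N) (C := 1) hA hlen hD hDU hW [row0 D W] rfl
    (fun c hc => by simp at hc) (by simpa using hC) (fun _ δ => GqN (termsFrom m A DA D (row0 D W) W Dd N 0 Cl) Dd δ)
    hδ (fun cc hcc => by
      have : cc = 0 := by simpa using hcc
      subst this; simp) (by simpa using h)
  simpa using this

end Summit.CriticalPhenomena.PercolationContinuityZ3.Theorems.Pcint.BSMR

end
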